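import Mathlib.Analysis.Calculus.ContDiff.Deriv
import Mathlib.Analysis.Calculus.Deriv.Slope
import Mathlib.Analysis.Calculus.IteratedDeriv.Lemmas
import Mathlib.MeasureTheory.Constructions.BorelSpace.Metrizable
import Literature.MathematicalPhysics.KineticTheory.InfiniteChainDynamics
import HarnessLib

/-!
# The equilibrium pair-path law `G_T` of the infinite oscillator chain

Topic `Literature/MathematicalPhysics/KineticTheory`; definition request
`defn-OscillatorChain.equilibriumPairPathLaw` (idea card
`AtomisticToContinuum/FouriersLaw/spatial-dynamics-slow-manifold`, route thesis
`SpatialSlowManifold`, upper-layer cruxes U1 `SpatialSpectralGap`, U2 `SlowManifoldBVP`).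

## The objects

Fix chain data `P : OscillatorChain` (pinning `U`, coupling `V`), an infinite-volume dynamics
`D : InfiniteChainDynamics P` (a flow `φ_t` on an invariant set of configurations `ℤ → ℝ × ℝ`
solving `q̇_i = p_i`, `ṗ_i = -U'(q_i) + V'(q_{i+1} - q_i) - V'(q_i - q_{i-1})`, Lanford–Lebowitz–Lieb
1977, §2 (1a)–(1c)) and a measure `μ` on configurations (intended: a Gibbs state `μ_T` at
temperature `T`, `P.IsChainGibbsMeasure T μ_T`, preserved by the flow, `D.PreservesMeasure μ_T` —
the stationary infinite-volume equilibrium process of LLL 1977, §4, Thms 3–4). Existence of such a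
pair `(μ_T, D)` is NOT part of this file (it is item `InfiniteVolumeSetup` of route
`FourierGreenKubo`); everything here is relative to a given pair.

* `SmoothPairPath` — the **pair-path space**: pairs of `C^∞` real paths `t ↦ (x(t), y(t))`,
  `t ∈ ℝ`, with the σ-algebra generated by the evaluations (the trace of the product σ-algebra);
  `timeShift s`, `IsTimeStationary`, and the class `IsTemperedStationaryLaw` /
  `temperedStationaryLaws` of time-stationary probability laws all of whose time-derivative
  moments `𝔼 ‖γ^{(k)}(0)‖^n` are finite (the thesis' "tempered time-stationary pair-path laws",
  the space on which the transfer map acts near `G_T`).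
* `InfiniteChainDynamics.orbitPair D i σ = (t ↦ (q_i(t), q_{i+1}(t)))`, the pair of position
  paths of the orbit of `σ` at the adjacent sites `i, i+1`; `pairPathOf` packages it as a
  `SmoothPairPath` (junk `0` unless smooth — on the carrier it IS smooth as soon as `U, V` are,
  `contDiff_orbitPair`); `sitePairPathLaw D μ i` is its law under `μ`.
* `OscillatorChain.equilibriumPairPathLaw P D μ` — **the notion requested**: `G_T`, the law on
  `SmoothPairPath` of `t ↦ (q_0(t), q_1(t))` for an initial configuration distributed by `μ`.
* `OscillatorChain.latticeShift` (`(τσ)_i = σ_{i+1}`) and the hypothesis bundle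
  `OscillatorChain.IsEquilibriumProcess P T D μ` (`T > 0`, `μ` Gibbs at `T`, `D` preserves `μ`,
  carrier and `μ` translation invariant).
* `OscillatorChain.spatialShiftFun / spatialShift` — the deterministic **spatial shift**
  `𝒮 (x, y) = (y, z)`, `z = y + (V')⁻¹(ÿ + U'(y) + V'(y - x))` (Newton's equation
  `ÿ = -U'(y) + V'(z - y) - V'(y - x)` of the lattice, Haragus–Iooss 2011 §5.2.3 eq. (2.33),
  solved for the right neighbour; "site index as time", the spatial-dynamics idea of
  Kirchgässner, ibid. §5.2, p. 262) and the transfer map `spatialTransfer P G = 𝒮_* G`.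
  The companion request `defn-OscillatorChain.spatialShift` was closed by the landing detector on
  an unrelated homonym (`Literature.MathematicalPhysics.KineticTheory.spatialShift` of
  `FluctuationSpace.lean`, translations of marked point configurations in `ℝ³`); the fixed-point
  property (ii) of this request needs the map, so its minimal version is vendored here (its
  inverse and the finite-`N` interior-triple statement are not).

## What is proved (API)

* smoothness bootstrap `IsSolution.contDiff_nat/contDiff_fst/contDiff_snd`: for `U, V ∈ C^∞`
  every coordinate of every solution is `C^∞` in time;
* `aemeasurable_pairPathOf`, `isProbabilityMeasure_sitePairPathLaw`: `G_T` is a probability law;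
* (i) `isTimeStationary_sitePairPathLaw`: `G_T` is time-stationary (`φ_s` preserves `μ` and
  `pairPathOf ∘ φ_s = timeShift s ∘ pairPathOf` on the carrier, from the group law);
* (ii) `flow_latticeShift` (the flow commutes with lattice translations, from uniqueness),
  `sitePairPathLaw_succ` / `sitePairPathLaw_eq_equilibriumPairPathLaw` (all adjacent pairs have
  the law `G_T` when `μ` is translation invariant), `spatialShiftFun_orbitPair` (Newton's equation
  at site `i+1`: `𝒮 (q_i, q_{i+1}) = (q_{i+1}, q_{i+2})` along orbits, `V'` injective),
  `measurable_spatialShift`, and the **fixed-point property**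
  `IsEquilibriumProcess.spatialTransfer_equilibriumPairPathLaw : 𝒮_* G_T = G_T`;
* (iii) is the definition `IsTemperedStationaryLaw`; membership of `G_T` (finiteness of all
  polynomial moments of the Gibbs state) is a claim for the route, not asserted here.

## References

* O. E. Lanford, J. L. Lebowitz, E. H. Lieb, Time evolution of infinite anharmonic systems,
  J. Stat. Phys. 16 (1977) 453–461, §4 Thms 3–4. [LanfordLebowitzLieb1977]
* M. Haragus, G. Iooss, Local Bifurcations, Center Manifolds, and Normal Forms in
  Infinite-Dimensional Dynamical Systems, Springer 2011, §5.2 (p. 262) and §5.2.3 eq. (2.33).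
  [HaragusIooss2011]
* F. Bonetto, J. L. Lebowitz, L. Rey-Bellet, Fourier's law: a challenge to theorists (2000), §4.2,
  §7. [BonettoLebowitzReyBellet2000]
-/

noncomputable section

open MeasureTheory Filter Topology Set Function
open scoped ContDiff

namespace Literature.MathematicalPhysics.KineticTheory.HeatConduction

/-! ### The pair-path space -/

/-- The **pair-path space**: pairs of smooth real paths `γ = (x, y) : ℝ → ℝ × ℝ`, `γ ∈ C^∞`
(two adjacent site trajectories `t ↦ (q_i(t), q_{i+1}(t))` of the chain). Its measurable
structure (the subtype instance) is the σ-algebra generated by the evaluations `γ ↦ γ(t)`, i.e.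
the trace of the product σ-algebra — the usual cylinder σ-algebra of path space. [folklore] -/
abbrev SmoothPairPath : Type := {γ : ℝ → ℝ × ℝ // ContDiff ℝ ∞ γ}

namespace SmoothPairPath

/-- The constant path at the origin (the junk value of `ofFun`). [folklore] -/
instance instZero : Zero SmoothPairPath := ⟨⟨fun _ => 0, contDiff_const⟩⟩

/-- The zero path is the constant `0`. [folklore] -/
@[simp] theorem coe_zero : ((0 : SmoothPairPath) : ℝ → ℝ × ℝ) = fun _ => 0 := rfl

/-- Evaluation at a time is measurable (it generates the σ-algebra). [folklore] -/
theorem measurable_apply (t : ℝ) : Measurable fun γ : SmoothPairPath => γ.1 t :=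
  (measurable_pi_apply t).comp measurable_subtype_coe

/-- A map into the pair-path space is measurable as soon as all its evaluations are. [folklore] -/
theorem measurable_of_apply {α : Type*} [MeasurableSpace α] {f : α → SmoothPairPath}
    (hf : ∀ t, Measurable fun a => (f a).1 t) : Measurable f :=
  (measurable_pi_lambda (fun a => (f a).1) hf).subtype_mk

open Classical in
/-- Package a function `ℝ → ℝ × ℝ` as a smooth pair path: itself if it is `C^∞`, the junk value
`0` otherwise. [folklore] -/
def ofFun (f : ℝ → ℝ × ℝ) : SmoothPairPath :=
  if h : ContDiff ℝ ∞ f then ⟨f, h⟩ else 0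

/-- `ofFun f = f` for smooth `f`. [folklore] -/
theorem ofFun_of_contDiff {f : ℝ → ℝ × ℝ} (h : ContDiff ℝ ∞ f) : ofFun f = ⟨f, h⟩ :=
  dif_pos h

/-- `ofFun f = 0` (junk) for non-smooth `f`. [folklore] -/
theorem ofFun_of_not_contDiff {f : ℝ → ℝ × ℝ} (h : ¬ContDiff ℝ ∞ f) : ofFun f = 0 :=
  dif_neg h

/-- The underlying function of `ofFun f` is `f` for smooth `f`. [folklore] -/
@[simp] theorem coe_ofFun {f : ℝ → ℝ × ℝ} (h : ContDiff ℝ ∞ f) : (ofFun f).1 = f := by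
  rw [ofFun_of_contDiff h]

/-- `ofFun` of a smooth pair path is itself. [folklore] -/
@[simp] theorem ofFun_coe (γ : SmoothPairPath) : ofFun γ.1 = γ := by
  rw [ofFun_of_contDiff γ.2]

/-! ### Time shift and time-stationary laws -/

/-- The time shift `(θ_s γ)(t) = γ(t + s)` on pair paths. [folklore] -/
def timeShift (s : ℝ) (γ : SmoothPairPath) : SmoothPairPath :=
  ⟨fun t => γ.1 (t + s), γ.2.comp (contDiff_id.add contDiff_const)⟩

/-- `(θ_s γ)(t) = γ(t + s)`. [folklore] -/
@[simp] theorem timeShift_apply (s : ℝ) (γ : SmoothPairPath) (t : ℝ) :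
    (timeShift s γ).1 t = γ.1 (t + s) := rfl

/-- `θ_0 = id`. [folklore] -/
@[simp] theorem timeShift_zero (γ : SmoothPairPath) : timeShift 0 γ = γ :=
  Subtype.ext (funext fun t => by simp)

/-- `θ_{s+u} = θ_s ∘ θ_u`. [folklore] -/
theorem timeShift_add (s u : ℝ) (γ : SmoothPairPath) :
    timeShift (s + u) γ = timeShift s (timeShift u γ) :=
  Subtype.ext (funext fun t => by simp only [timeShift_apply]; rw [add_assoc])

/-- The zero path is shift invariant. [folklore] -/
@[simp] theorem timeShift_zero_path (s : ℝ) : timeShift s (0 : SmoothPairPath) = 0 := rfl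

/-- Time shifts are measurable. [folklore] -/
theorem measurable_timeShift (s : ℝ) : Measurable (timeShift s) :=
  measurable_of_apply fun t => measurable_apply (t + s)

/-- `ofFun` intertwines pre-composition with a time translation and `timeShift` (including the
junk branch: a function is smooth iff its translate is). [folklore] -/
theorem ofFun_comp_add_right (f : ℝ → ℝ × ℝ) (s : ℝ) :
    ofFun (fun t => f (t + s)) = timeShift s (ofFun f) := by
  by_cases h : ContDiff ℝ ∞ f
  · have h' : ContDiff ℝ ∞ fun t => f (t + s) := h.comp (contDiff_id.add contDiff_const)
    rw [ofFun_of_contDiff h', ofFun_of_contDiff h]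
    rfl
  · have h' : ¬ContDiff ℝ ∞ fun t => f (t + s) := by
      intro h'
      apply h
      have h'' : ContDiff ℝ ∞ fun t => (fun u => f (u + s)) (t + -s) :=
        h'.comp (contDiff_id.add contDiff_const)
      simpa using h''
    rw [ofFun_of_not_contDiff h', ofFun_of_not_contDiff h]
    rfl

/-- A law `G` on pair paths is **time-stationary**: `(θ_s)_* G = G` for every `s ∈ ℝ`. [folklore] -/
def IsTimeStationary (G : Measure SmoothPairPath) : Prop :=
  ∀ s : ℝ, G.map (timeShift s) = G

/-- A **tempered time-stationary pair-path law**: a time-stationary probability law on smooth pair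
paths all of whose time-derivative moments at time `0` (hence, by stationarity, at every time)
are finite, `𝔼_G ‖γ^{(k)}(0)‖^n < ∞` for all `k, n ∈ ℕ` — the space on which the spatial transfer
map `𝒮_*` is to act near `G_T` (route thesis `SpatialSlowManifold`, U1; interior NESS trajectories
are smooth in time). [folklore] -/
def IsTemperedStationaryLaw (G : Measure SmoothPairPath) : Prop :=
  IsProbabilityMeasure G ∧ IsTimeStationary G ∧
    ∀ k n : ℕ, Integrable (fun γ : SmoothPairPath => ‖iteratedDeriv k γ.1 0‖ ^ n) G

/-- The set of tempered time-stationary pair-path laws. [folklore] -/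
def temperedStationaryLaws : Set (Measure SmoothPairPath) :=
  {G | IsTemperedStationaryLaw G}

/-- Unfolding `temperedStationaryLaws`. [folklore] -/
@[simp] theorem mem_temperedStationaryLaws (G : Measure SmoothPairPath) :
    G ∈ temperedStationaryLaws ↔ IsTemperedStationaryLaw G :=
  Iff.rfl

/-- A tempered stationary law is a time-stationary probability law. [folklore] -/
theorem IsTemperedStationaryLaw.isTimeStationary {G : Measure SmoothPairPath}
    (h : IsTemperedStationaryLaw G) : IsProbabilityMeasure G ∧ IsTimeStationary G :=
  ⟨h.1, h.2.1⟩

/-! ### Measurability of time derivatives on the pair-path space -/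

/-- Difference quotients along `h_n = 1/(n+1)` converge to the derivative. [folklore] -/
theorem tendsto_slope_seq {F : Type*} [NormedAddCommGroup F] [NormedSpace ℝ F] {g : ℝ → F}
    {g' : F} {t : ℝ} (hg : HasDerivAt g g' t) :
    Tendsto (fun n : ℕ => ((n : ℝ) + 1) • (g (t + ((n : ℝ) + 1)⁻¹) - g t)) atTop (𝓝 g') := by
  have h1 : Tendsto (fun n : ℕ => t + ((n : ℝ) + 1)⁻¹) atTop (𝓝[≠] t) := by
    refine tendsto_nhdsWithin_iff.2 ⟨?_, Eventually.of_forall fun n => ?_⟩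
    · have h0 : Tendsto (fun n : ℕ => ((n : ℝ) + 1)⁻¹) atTop (𝓝 0) := by
        simpa only [one_div] using tendsto_one_div_add_atTop_nhds_zero_nat (𝕜 := ℝ)
      simpa using tendsto_const_nhds.add h0
    · have hpos : (0 : ℝ) < ((n : ℝ) + 1)⁻¹ := by positivity
      simp only [mem_compl_iff, mem_singleton_iff, add_eq_left]
      exact hpos.ne'
  refine ((hasDerivAt_iff_tendsto_slope.1 hg).comp h1).congr fun n => ?_
  simp only [Function.comp_apply, slope_def_module, add_sub_cancel_left, inv_inv]

/-- For a continuous linear functional `ℓ` on `ℝ × ℝ`, the iterated time derivative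
`γ ↦ (d/dt)^k (ℓ ∘ γ)(t)` is measurable on the pair-path space: by induction, each derivative is a
pointwise limit of measurable difference quotients. [folklore] -/
theorem measurable_iterate_deriv_apply (ℓ : ℝ × ℝ →L[ℝ] ℝ) (k : ℕ) (t : ℝ) :
    Measurable fun γ : SmoothPairPath => deriv^[k] (fun s => ℓ (γ.1 s)) t := by
  induction k generalizing t with
  | zero => exact ℓ.continuous.measurable.comp (measurable_apply t)
  | succ k ih =>
    have hsm : ∀ γ : SmoothPairPath, ContDiff ℝ ∞ (deriv^[k] fun s => ℓ (γ.1 s)) := fun γ =>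
      (ℓ.contDiff.comp γ.2).iterate_deriv k
    refine measurable_of_tendsto_metrizable (f := fun (n : ℕ) (γ : SmoothPairPath) =>
      ((n : ℝ) + 1) • (deriv^[k] (fun s => ℓ (γ.1 s)) (t + ((n : ℝ) + 1)⁻¹) -
        deriv^[k] (fun s => ℓ (γ.1 s)) t))
      (fun n => ((ih (t + ((n : ℝ) + 1)⁻¹)).fun_sub (ih t)).fun_const_smul ((n : ℝ) + 1)) ?_
    rw [tendsto_pi_nhds]
    intro γ
    simp only [Function.iterate_succ_apply']
    exact tendsto_slope_seq ((contDiff_infty_iff_deriv.1 (hsm γ)).1 t).hasDerivAt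

/-- Measurability of `γ ↦ (ℓ ∘ γ)^{(k)}(t)` in the `iteratedDeriv` spelling. [folklore] -/
theorem measurable_iteratedDeriv_apply (ℓ : ℝ × ℝ →L[ℝ] ℝ) (k : ℕ) (t : ℝ) :
    Measurable fun γ : SmoothPairPath => iteratedDeriv k (fun s => ℓ (γ.1 s)) t := by
  simpa only [iteratedDeriv_eq_iterate] using measurable_iterate_deriv_apply ℓ k t

end SmoothPairPath

/-! ### Lattice translations and smoothness of orbits -/

namespace OscillatorChain

/-- The lattice translation of configurations, `(τ σ)_i = σ_{i+1}` (so that the pair at sites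
`(1, 2)` of `σ` is the pair at sites `(0, 1)` of `τ σ`), as a measurable equivalence. [folklore] -/
def latticeShift : ChainConfig ≃ᵐ ChainConfig where
  toFun σ i := σ (i + 1)
  invFun σ i := σ (i - 1)
  left_inv σ := funext fun i => by simp
  right_inv σ := funext fun i => by simp
  measurable_toFun := measurable_pi_lambda _ fun i => measurable_pi_apply (i + 1)
  measurable_invFun := measurable_pi_lambda _ fun i => measurable_pi_apply (i - 1)

/-- `(τ σ)_i = σ_{i+1}`. [folklore] -/
@[simp] theorem latticeShift_apply (σ : ChainConfig) (i : ℤ) : latticeShift σ i = σ (i + 1) := rfl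

/-- `(τ⁻¹ σ)_i = σ_{i-1}`. [folklore] -/
@[simp] theorem latticeShift_symm_apply (σ : ChainConfig) (i : ℤ) :
    latticeShift.symm σ i = σ (i - 1) := rfl

variable (P : OscillatorChain)

/-- The force is translation covariant: `F_i(τ σ) = F_{i+1}(σ)`. [folklore] -/
theorem force_latticeShift (σ : ChainConfig) (i : ℤ) :
    P.force (latticeShift σ) i = P.force σ (i + 1) := by
  simp only [force, interactionForce, latticeShift_apply, sub_add_cancel, add_sub_cancel_right]

variable {P}

/-- Translates of solutions are solutions (the equations of motion are translation invariant).
[folklore] -/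
theorem IsSolution.latticeShift {γ : ℝ → ChainConfig} (hγ : P.IsSolution γ) :
    P.IsSolution fun t => OscillatorChain.latticeShift (γ t) := by
  intro i t
  refine ⟨?_, ?_⟩
  · simpa only [latticeShift_apply] using (hγ (i + 1) t).1
  · have h := (hγ (i + 1) t).2
    rw [← force_latticeShift] at h
    simpa only [latticeShift_apply] using h

/-- **Smoothness bootstrap.** If `U, V ∈ C^∞` then every coordinate `q_i, p_i` of a solution of
(1a)–(1b) is `C^n` in time for every `n`: `q̇_i = p_i`, `ṗ_i = F_i(q)` with `F_i` a smooth
function of `q_{i-1}, q_i, q_{i+1}`. [folklore] -/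
theorem IsSolution.contDiff_nat {γ : ℝ → ChainConfig} (hγ : P.IsSolution γ)
    (hU : ContDiff ℝ ∞ P.U) (hV : ContDiff ℝ ∞ P.V) (n : ℕ) (i : ℤ) :
    ContDiff ℝ n (fun t => (γ t i).1) ∧ ContDiff ℝ n (fun t => (γ t i).2) := by
  induction n generalizing i with
  | zero =>
    rw [Nat.cast_zero]
    exact ⟨contDiff_zero.2 (continuous_iff_continuousAt.2 fun t => (hγ i t).1.continuousAt),
      contDiff_zero.2 (continuous_iff_continuousAt.2 fun t => (hγ i t).2.continuousAt)⟩
  | succ n ih =>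
    have hdU : ContDiff ℝ n (deriv P.U) :=
      (contDiff_infty_iff_deriv.1 hU).2.of_le (mod_cast le_top)
    have hdV : ContDiff ℝ n (deriv P.V) :=
      (contDiff_infty_iff_deriv.1 hV).2.of_le (mod_cast le_top)
    have hq : deriv (fun t => (γ t i).1) = fun t => (γ t i).2 :=
      funext fun t => (hγ i t).1.deriv
    have hp : deriv (fun t => (γ t i).2) = fun t => P.force (γ t) i :=
      funext fun t => (hγ i t).2.deriv
    have hF : ContDiff ℝ n fun t => P.force (γ t) i := by
      have h0 := (ih i).1
      have h1 := (ih (i + 1)).1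
      have h2 := (ih (i - 1)).1
      simp only [force, interactionForce]
      exact ((hdU.comp h0).neg).add ((hdV.comp (h1.sub h0)).sub (hdV.comp (h0.sub h2)))
    refine ⟨?_, ?_⟩
    · rw [Nat.cast_succ, contDiff_succ_iff_deriv, hq]
      exact ⟨fun t => (hγ i t).1.differentiableAt, fun h => by simp at h, (ih i).2⟩
    · rw [Nat.cast_succ, contDiff_succ_iff_deriv, hp]
      exact ⟨fun t => (hγ i t).2.differentiableAt, fun h => by simp at h, hF⟩

/-- Positions of a solution are `C^∞` in time when `U, V ∈ C^∞`. [folklore] -/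
theorem IsSolution.contDiff_fst {γ : ℝ → ChainConfig} (hγ : P.IsSolution γ)
    (hU : ContDiff ℝ ∞ P.U) (hV : ContDiff ℝ ∞ P.V) (i : ℤ) :
    ContDiff ℝ ∞ fun t => (γ t i).1 :=
  contDiff_infty.2 fun n => (hγ.contDiff_nat hU hV n i).1

/-- Momenta of a solution are `C^∞` in time when `U, V ∈ C^∞`. [folklore] -/
theorem IsSolution.contDiff_snd {γ : ℝ → ChainConfig} (hγ : P.IsSolution γ)
    (hU : ContDiff ℝ ∞ P.U) (hV : ContDiff ℝ ∞ P.V) (i : ℤ) :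
    ContDiff ℝ ∞ fun t => (γ t i).2 :=
  contDiff_infty.2 fun n => (hγ.contDiff_nat hU hV n i).2

end OscillatorChain

/-! ### Pair paths of orbits and their laws -/

namespace InfiniteChainDynamics

variable {P : OscillatorChain} (D : InfiniteChainDynamics P)

/-- The pair of position paths of the orbit of `σ` at the adjacent sites `i, i+1`:
`t ↦ (q_i(t), q_{i+1}(t)) = (((φ_t σ) i).1, ((φ_t σ) (i+1)).1)`. [cite: LanfordLebowitzLieb1977, §4 Thm 3] -/
def orbitPair (i : ℤ) (σ : ChainConfig) : ℝ → ℝ × ℝ :=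
  fun t => ((D.flow t σ i).1, (D.flow t σ (i + 1)).1)

/-- Unfolding `orbitPair`. [folklore] -/
@[simp] theorem orbitPair_apply (i : ℤ) (σ : ChainConfig) (t : ℝ) :
    D.orbitPair i σ t = ((D.flow t σ i).1, (D.flow t σ (i + 1)).1) := rfl

/-- On the carrier, orbit pair paths are smooth when `U, V ∈ C^∞`. [folklore] -/
theorem contDiff_orbitPair (hU : ContDiff ℝ ∞ P.U) (hV : ContDiff ℝ ∞ P.V) {σ : ChainConfig}
    (hσ : σ ∈ D.carrier) (i : ℤ) : ContDiff ℝ ∞ (D.orbitPair i σ) :=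
  ((D.isSolution σ hσ).contDiff_fst hU hV i).prodMk
    ((D.isSolution σ hσ).contDiff_fst hU hV (i + 1))

/-- Orbit pair paths are measurable in the initial condition when every `φ_t` is. [folklore] -/
theorem measurable_orbitPair (hm : ∀ t, Measurable (D.flow t)) (i : ℤ) :
    Measurable (D.orbitPair i) :=
  measurable_pi_lambda _ fun t =>
    (measurable_fst.comp ((measurable_pi_apply i).comp (hm t))).prodMk
      (measurable_fst.comp ((measurable_pi_apply (i + 1)).comp (hm t)))

/-- The group law in pair-path form: the orbit pair of `φ_s σ` is the time translate of that of
`σ`. [folklore] -/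
theorem orbitPair_flow {σ : ChainConfig} (hσ : σ ∈ D.carrier) (i : ℤ) (s : ℝ) :
    D.orbitPair i (D.flow s σ) = fun t => D.orbitPair i σ (t + s) := by
  funext t
  simp only [orbitPair_apply, ← D.flow_add hσ t s]

/-- The orbit pair path of `σ` at sites `i, i+1`, as an element of the pair-path space (junk `0`
if it is not smooth, which does not happen on the carrier for smooth `U, V`, `coe_pairPathOf`).
[cite: LanfordLebowitzLieb1977, §4 Thm 3] -/
def pairPathOf (i : ℤ) (σ : ChainConfig) : SmoothPairPath :=
  SmoothPairPath.ofFun (D.orbitPair i σ)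

/-- On the carrier (smooth potentials) `pairPathOf` is the orbit pair path. [folklore] -/
theorem coe_pairPathOf (hU : ContDiff ℝ ∞ P.U) (hV : ContDiff ℝ ∞ P.V) {σ : ChainConfig}
    (hσ : σ ∈ D.carrier) (i : ℤ) : (D.pairPathOf i σ).1 = D.orbitPair i σ :=
  SmoothPairPath.coe_ofFun (D.contDiff_orbitPair hU hV hσ i)

/-- `pairPathOf ∘ φ_s = θ_s ∘ pairPathOf` on the carrier (no smoothness needed: both sides are
junk together). [folklore] -/
theorem pairPathOf_flow {σ : ChainConfig} (hσ : σ ∈ D.carrier) (i : ℤ) (s : ℝ) :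
    D.pairPathOf i (D.flow s σ) = SmoothPairPath.timeShift s (D.pairPathOf i σ) := by
  rw [pairPathOf, D.orbitPair_flow hσ i s, SmoothPairPath.ofFun_comp_add_right]
  rfl

/-- For a preserved measure and smooth potentials, `pairPathOf` is a.e.-measurable: it agrees,
off a null measurable set containing the complement of the carrier, with the measurable map
`σ ↦ orbitPair i σ`. [folklore] -/
theorem aemeasurable_pairPathOf (hU : ContDiff ℝ ∞ P.U) (hV : ContDiff ℝ ∞ P.V)
    {μ : Measure ChainConfig} (hμ : D.PreservesMeasure μ) (i : ℤ) :
    AEMeasurable (D.pairPathOf i) μ := by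
  classical
  set N : Set ChainConfig := toMeasurable μ {σ | σ ∉ D.carrier} with hN
  have hNm : MeasurableSet N := measurableSet_toMeasurable _ _
  have hNc : ∀ σ, σ ∉ N → σ ∈ D.carrier := fun σ hσ =>
    by_contra fun h => hσ (subset_toMeasurable μ {σ | σ ∉ D.carrier} h)
  have hμN : μ N = 0 := by
    rw [hN, measure_toMeasurable]
    exact ae_iff.1 hμ.1
  have hmo : Measurable (D.orbitPair i) := D.measurable_orbitPair (fun t => (hμ.2 t).measurable) i
  let g : ChainConfig → SmoothPairPath := fun σ =>
    ⟨N.piecewise (fun _ _ => (0 : ℝ × ℝ)) (D.orbitPair i) σ, by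
      by_cases h : σ ∈ N
      · rw [Set.piecewise_eq_of_mem _ _ _ h]
        exact contDiff_const
      · rw [Set.piecewise_eq_of_notMem _ _ _ h]
        exact D.contDiff_orbitPair hU hV (hNc σ h) i⟩
  have hg : Measurable g := (Measurable.piecewise hNm measurable_const hmo).subtype_mk
  refine ⟨g, hg, ?_⟩
  filter_upwards [measure_eq_zero_iff_ae_notMem.1 hμN] with σ hσ
  refine Subtype.ext ?_
  rw [D.coe_pairPathOf hU hV (hNc σ hσ) i]
  change D.orbitPair i σ = N.piecewise (fun _ _ => (0 : ℝ × ℝ)) (D.orbitPair i) σ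
  rw [Set.piecewise_eq_of_notMem _ _ _ hσ]

/-- The **law of the pair path at sites `i, i+1`** under `μ`: the push-forward of `μ` by
`σ ↦ (t ↦ (q_i(t), q_{i+1}(t)))`. [cite: LanfordLebowitzLieb1977, §4 Thm 3] -/
def sitePairPathLaw (μ : Measure ChainConfig) (i : ℤ) : Measure SmoothPairPath :=
  μ.map (D.pairPathOf i)

/-- The pair-path law is a probability law (preserved probability measure, smooth potentials).
[folklore] -/
theorem isProbabilityMeasure_sitePairPathLaw (hU : ContDiff ℝ ∞ P.U) (hV : ContDiff ℝ ∞ P.V)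
    {μ : Measure ChainConfig} [IsProbabilityMeasure μ] (hμ : D.PreservesMeasure μ) (i : ℤ) :
    IsProbabilityMeasure (D.sitePairPathLaw μ i) :=
  Measure.isProbabilityMeasure_map (D.aemeasurable_pairPathOf hU hV hμ i)

/-- **(i) Time-stationarity.** If `D` preserves `μ` (and `U, V ∈ C^∞`), the pair-path law is
invariant under every time shift: `(θ_s)_* G = G`. [folklore] -/
theorem isTimeStationary_sitePairPathLaw (hU : ContDiff ℝ ∞ P.U) (hV : ContDiff ℝ ∞ P.V)
    {μ : Measure ChainConfig} (hμ : D.PreservesMeasure μ) (i : ℤ) :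
    SmoothPairPath.IsTimeStationary (D.sitePairPathLaw μ i) := by
  intro s
  have hae : AEMeasurable (D.pairPathOf i) μ := D.aemeasurable_pairPathOf hU hV hμ i
  have hflow : μ.map (D.flow s) = μ := (hμ.2 s).map_eq
  have hae' : AEMeasurable (D.pairPathOf i) (μ.map (D.flow s)) := by rwa [hflow]
  calc (μ.map (D.pairPathOf i)).map (SmoothPairPath.timeShift s)
      = μ.map (SmoothPairPath.timeShift s ∘ D.pairPathOf i) :=
        AEMeasurable.map_map_of_aemeasurable
          (SmoothPairPath.measurable_timeShift s).aemeasurable hae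
    _ = μ.map (D.pairPathOf i ∘ D.flow s) := by
        refine Measure.map_congr ?_
        filter_upwards [hμ.1] with σ hσ
        simp only [Function.comp_apply, D.pairPathOf_flow hσ]
    _ = (μ.map (D.flow s)).map (D.pairPathOf i) :=
        (AEMeasurable.map_map_of_aemeasurable hae' (hμ.2 s).measurable.aemeasurable).symm
    _ = μ.map (D.pairPathOf i) := by rw [hflow]

/-- **Translation covariance of the flow.** If the carrier is translation invariant, the flow
commutes with the lattice translation on it (uniqueness of solutions within the carrier applied
to the translated orbit). [folklore] -/
theorem flow_latticeShift
    (hc : ∀ σ, OscillatorChain.latticeShift σ ∈ D.carrier ↔ σ ∈ D.carrier)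
    {σ : ChainConfig} (hσ : σ ∈ D.carrier) (t : ℝ) :
    D.flow t (OscillatorChain.latticeShift σ) = OscillatorChain.latticeShift (D.flow t σ) := by
  have h := D.unique (fun u => OscillatorChain.latticeShift (D.flow u σ))
    (fun u => (hc _).2 (D.flow_mem hσ u)) (D.isSolution σ hσ).latticeShift t
  rw [D.flow_zero σ hσ] at h
  exact h.symm

/-- The orbit pair of the translated configuration at sites `i, i+1` is the orbit pair at sites
`i+1, i+2`. [folklore] -/
theorem orbitPair_latticeShift
    (hc : ∀ σ, OscillatorChain.latticeShift σ ∈ D.carrier ↔ σ ∈ D.carrier)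
    {σ : ChainConfig} (hσ : σ ∈ D.carrier) (i : ℤ) :
    D.orbitPair i (OscillatorChain.latticeShift σ) = D.orbitPair (i + 1) σ := by
  funext t
  simp only [orbitPair_apply, D.flow_latticeShift hc hσ, OscillatorChain.latticeShift_apply]

/-- `pairPathOf i ∘ τ = pairPathOf (i+1)` on the carrier. [folklore] -/
theorem pairPathOf_latticeShift
    (hc : ∀ σ, OscillatorChain.latticeShift σ ∈ D.carrier ↔ σ ∈ D.carrier)
    {σ : ChainConfig} (hσ : σ ∈ D.carrier) (i : ℤ) :
    D.pairPathOf i (OscillatorChain.latticeShift σ) = D.pairPathOf (i + 1) σ := by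
  rw [pairPathOf, pairPathOf, D.orbitPair_latticeShift hc hσ i]

/-- **(ii), marginal form.** For a translation-invariant preserved measure on a
translation-invariant carrier, the pair-path laws at sites `(i+1, i+2)` and `(i, i+1)` coincide.
[folklore] -/
theorem sitePairPathLaw_succ (hU : ContDiff ℝ ∞ P.U) (hV : ContDiff ℝ ∞ P.V)
    {μ : Measure ChainConfig} (hμ : D.PreservesMeasure μ)
    (hc : ∀ σ, OscillatorChain.latticeShift σ ∈ D.carrier ↔ σ ∈ D.carrier)
    (hinv : μ.map OscillatorChain.latticeShift = μ) (i : ℤ) :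
    D.sitePairPathLaw μ (i + 1) = D.sitePairPathLaw μ i := by
  have hae : AEMeasurable (D.pairPathOf i) μ := D.aemeasurable_pairPathOf hU hV hμ i
  have hae' : AEMeasurable (D.pairPathOf i) (μ.map OscillatorChain.latticeShift) := by rwa [hinv]
  calc μ.map (D.pairPathOf (i + 1))
      = μ.map (D.pairPathOf i ∘ OscillatorChain.latticeShift) := by
        refine Measure.map_congr ?_
        filter_upwards [hμ.1] with σ hσ
        simp only [Function.comp_apply, D.pairPathOf_latticeShift hc hσ i]
    _ = (μ.map OscillatorChain.latticeShift).map (D.pairPathOf i) :=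
        (AEMeasurable.map_map_of_aemeasurable hae'
          OscillatorChain.latticeShift.measurable.aemeasurable).symm
    _ = μ.map (D.pairPathOf i) := by rw [hinv]

end InfiniteChainDynamics

/-! ### The equilibrium pair-path law `G_T` -/

namespace OscillatorChain

/-- The **equilibrium pair-path law `G_T`** of the chain `P` for the infinite-volume dynamics `D`
in the state `μ`: the law, on the pair-path space, of the two adjacent position trajectories
`t ↦ (q_0(t), q_1(t)) = (((φ_t σ) 0).1, ((φ_t σ) 1).1)` when the initial configuration `σ` is
distributed by `μ`. Intended use: `μ = μ_T` a Gibbs state of `P` at temperature `T`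
(`P.IsChainGibbsMeasure T μ_T`) preserved by `D` (`D.PreservesMeasure μ_T`) — the stationary
infinite-volume equilibrium process of Lanford–Lebowitz–Lieb (§4, Thms 3–4; invariance of the
Gibbs state under the infinite-volume flow is a separate claim, cf. `InfiniteChainDynamics`);
then `G_T` is a time-stationary probability law (`isTimeStationary_equilibriumPairPathLaw`) and a
fixed point of the spatial transfer map (`IsEquilibriumProcess.spatialTransfer_equilibriumPairPathLaw`).
[cite: LanfordLebowitzLieb1977, §4 Thms 3–4] -/
def equilibriumPairPathLaw (P : OscillatorChain) (D : InfiniteChainDynamics P)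
    (μ : Measure ChainConfig) : Measure SmoothPairPath :=
  D.sitePairPathLaw μ 0

variable (P : OscillatorChain)

/-- `G_T` is the pair-path law at sites `(0, 1)`. [folklore] -/
theorem equilibriumPairPathLaw_eq (D : InfiniteChainDynamics P) (μ : Measure ChainConfig) :
    P.equilibriumPairPathLaw D μ = μ.map (D.pairPathOf 0) := rfl

/-- `G_T` is a probability law (preserved probability measure, smooth potentials). [folklore] -/
theorem isProbabilityMeasure_equilibriumPairPathLaw (hU : ContDiff ℝ ∞ P.U)
    (hV : ContDiff ℝ ∞ P.V) (D : InfiniteChainDynamics P) {μ : Measure ChainConfig}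
    [IsProbabilityMeasure μ] (hμ : D.PreservesMeasure μ) :
    IsProbabilityMeasure (P.equilibriumPairPathLaw D μ) :=
  D.isProbabilityMeasure_sitePairPathLaw hU hV hμ 0

/-- **(i)** `G_T` is time-stationary when `D` preserves `μ`. [folklore] -/
theorem isTimeStationary_equilibriumPairPathLaw (hU : ContDiff ℝ ∞ P.U)
    (hV : ContDiff ℝ ∞ P.V) (D : InfiniteChainDynamics P) {μ : Measure ChainConfig}
    (hμ : D.PreservesMeasure μ) :
    SmoothPairPath.IsTimeStationary (P.equilibriumPairPathLaw D μ) :=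
  D.isTimeStationary_sitePairPathLaw hU hV hμ 0

/-- All adjacent pairs have the law `G_T` when, in addition, `μ` and the carrier are translation
invariant. [folklore] -/
theorem sitePairPathLaw_eq_equilibriumPairPathLaw (hU : ContDiff ℝ ∞ P.U)
    (hV : ContDiff ℝ ∞ P.V) (D : InfiniteChainDynamics P) {μ : Measure ChainConfig}
    (hμ : D.PreservesMeasure μ)
    (hc : ∀ σ, OscillatorChain.latticeShift σ ∈ D.carrier ↔ σ ∈ D.carrier)
    (hinv : μ.map OscillatorChain.latticeShift = μ) (i : ℤ) :
    D.sitePairPathLaw μ i = P.equilibriumPairPathLaw D μ := by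
  induction i using Int.induction_on with
  | zero => rfl
  | succ n ih => rw [D.sitePairPathLaw_succ hU hV hμ hc hinv, ih]
  | pred n ih =>
    have h := D.sitePairPathLaw_succ hU hV hμ hc hinv (-(n : ℤ) - 1)
    rw [sub_add_cancel] at h
    rw [← h, ih]

/-! ### The spatial shift `𝒮` and the transfer map `𝒮_*` -/

/-- The **spatial shift** on pairs of paths, as a map of plain functions:
`𝒮 (x, y) = (y, z)`, `z(t) = y(t) + (V')⁻¹( ÿ(t) + U'(y(t)) + V'(y(t) - x(t)) )`, i.e. Newton's
equation of the lattice at the middle site, `ÿ = -U'(y) + V'(z - y) - V'(y - x)`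
(Haragus–Iooss 2011, §5.2.3 eq. (2.33) with `W = U`), solved for the right neighbour `z`
(`(V')⁻¹ = Function.invFun (deriv V)`, a genuine inverse when `V'` is a bijection, e.g.
`V'(r) = r + βr³`, `β > 0`, for `pinnedChain`); "site index as time" is the spatial-dynamics idea of
Kirchgässner (ibid. §5.2, p. 262). [cite: HaragusIooss2011, §5.2.3 eq. (2.33)] -/
def spatialShiftFun (γ : ℝ → ℝ × ℝ) : ℝ → ℝ × ℝ := fun t =>
  ((γ t).2, (γ t).2 + Function.invFun (deriv P.V)
    (iteratedDeriv 2 (fun s => (γ s).2) t + deriv P.U (γ t).2 + deriv P.V ((γ t).2 - (γ t).1)))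

/-- The **spatial shift `𝒮`** on the pair-path space (junk `0` if the image is not smooth, which
does not happen when `U`, `V` and `(V')⁻¹` are smooth, `spatialShift_eq`). [cite: HaragusIooss2011, §5.2.3 eq. (2.33)] -/
def spatialShift (γ : SmoothPairPath) : SmoothPairPath :=
  SmoothPairPath.ofFun (P.spatialShiftFun γ.1)

/-- The **spatial transfer map `𝒮_*`** on laws of pair paths: push-forward by `𝒮`. [cite: HaragusIooss2011, §5.2.3 eq. (2.33)] -/
def spatialTransfer (G : Measure SmoothPairPath) : Measure SmoothPairPath :=
  G.map P.spatialShift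

/-- Unfolding `spatialTransfer`. [folklore] -/
theorem spatialTransfer_eq (G : Measure SmoothPairPath) :
    P.spatialTransfer G = G.map P.spatialShift := rfl

/-- The image of a smooth pair path under `𝒮` is smooth when `U`, `V` and `(V')⁻¹` are.
[folklore] -/
theorem contDiff_spatialShiftFun (hU : ContDiff ℝ ∞ P.U) (hV : ContDiff ℝ ∞ P.V)
    (hW : ContDiff ℝ ∞ (Function.invFun (deriv P.V))) (γ : SmoothPairPath) :
    ContDiff ℝ ∞ (P.spatialShiftFun γ.1) := by
  have h1 : ContDiff ℝ ∞ fun s => (γ.1 s).1 := contDiff_fst.comp γ.2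
  have h2 : ContDiff ℝ ∞ fun s => (γ.1 s).2 := contDiff_snd.comp γ.2
  have hdd : ContDiff ℝ ∞ (iteratedDeriv 2 fun s => (γ.1 s).2) := by
    rw [iteratedDeriv_eq_iterate]
    exact h2.iterate_deriv 2
  have hdU : ContDiff ℝ ∞ (deriv P.U) := (contDiff_infty_iff_deriv.1 hU).2
  have hdV : ContDiff ℝ ∞ (deriv P.V) := (contDiff_infty_iff_deriv.1 hV).2
  exact h2.prodMk (h2.add (hW.comp ((hdd.add (hdU.comp h2)).add (hdV.comp (h2.sub h1)))))

/-- Junk-free form of `𝒮` under the smoothness hypotheses. [folklore] -/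
theorem spatialShift_eq (hU : ContDiff ℝ ∞ P.U) (hV : ContDiff ℝ ∞ P.V)
    (hW : ContDiff ℝ ∞ (Function.invFun (deriv P.V))) (γ : SmoothPairPath) :
    P.spatialShift γ = ⟨P.spatialShiftFun γ.1, P.contDiff_spatialShiftFun hU hV hW γ⟩ :=
  SmoothPairPath.ofFun_of_contDiff _

/-- `𝒮` is measurable for the cylinder σ-algebra (its evaluations are measurable functions of
`γ(t)` and `ÿ(t)`, the latter by `SmoothPairPath.measurable_iteratedDeriv_apply`). [folklore] -/
theorem measurable_spatialShift (hU : ContDiff ℝ ∞ P.U) (hV : ContDiff ℝ ∞ P.V)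
    (hW : ContDiff ℝ ∞ (Function.invFun (deriv P.V))) : Measurable P.spatialShift := by
  have heq : P.spatialShift =
      fun γ => ⟨P.spatialShiftFun γ.1, P.contDiff_spatialShiftFun hU hV hW γ⟩ :=
    funext (P.spatialShift_eq hU hV hW)
  rw [heq]
  refine SmoothPairPath.measurable_of_apply fun t => ?_
  have hm1 : Measurable fun γ : SmoothPairPath => (γ.1 t).1 :=
    measurable_fst.comp (SmoothPairPath.measurable_apply t)
  have hm2 : Measurable fun γ : SmoothPairPath => (γ.1 t).2 :=
    measurable_snd.comp (SmoothPairPath.measurable_apply t)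
  have hdd : Measurable fun γ : SmoothPairPath => iteratedDeriv 2 (fun s => (γ.1 s).2) t := by
    simpa using SmoothPairPath.measurable_iteratedDeriv_apply (ContinuousLinearMap.snd ℝ ℝ ℝ) 2 t
  have hWm : Measurable (Function.invFun (deriv P.V)) := hW.continuous.measurable
  have hUm : Measurable (deriv P.U) := (contDiff_infty_iff_deriv.1 hU).2.continuous.measurable
  have hVm : Measurable (deriv P.V) := (contDiff_infty_iff_deriv.1 hV).2.continuous.measurable
  exact hm2.prodMk (hm2.add (hWm.comp ((hdd.add (hUm.comp hm2)).add (hVm.comp (hm2.sub hm1)))))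

/-- **Newton's equation at site `i+1`, solved for `q_{i+2}`:** along an orbit in the carrier,
`𝒮 (q_i, q_{i+1}) = (q_{i+1}, q_{i+2})` as functions, provided `V'` is injective. [cite: HaragusIooss2011, §5.2.3 eq. (2.33)] -/
theorem spatialShiftFun_orbitPair (D : InfiniteChainDynamics P) (hinj : Injective (deriv P.V))
    {σ : ChainConfig} (hσ : σ ∈ D.carrier) (i : ℤ) :
    P.spatialShiftFun (D.orbitPair i σ) = D.orbitPair (i + 1) σ := by
  funext t
  have hsol := D.isSolution σ hσ
  have hq : deriv (fun s => (D.flow s σ (i + 1)).1) = fun s => (D.flow s σ (i + 1)).2 :=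
    funext fun s => (hsol (i + 1) s).1.deriv
  have hp : deriv (fun s => (D.flow s σ (i + 1)).2) = fun s => P.force (D.flow s σ) (i + 1) :=
    funext fun s => (hsol (i + 1) s).2.deriv
  have h2 : iteratedDeriv 2 (fun s => (D.orbitPair i σ s).2) t = P.force (D.flow t σ) (i + 1) := by
    have : (fun s => (D.orbitPair i σ s).2) = fun s => (D.flow s σ (i + 1)).1 := rfl
    rw [this, iteratedDeriv_eq_iterate]
    show deriv (deriv fun s => (D.flow s σ (i + 1)).1) t = _
    rw [hq, hp]
  have key : P.force (D.flow t σ) (i + 1) + deriv P.U (D.flow t σ (i + 1)).1 +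
      deriv P.V ((D.flow t σ (i + 1)).1 - (D.flow t σ i).1) =
      deriv P.V ((D.flow t σ (i + 1 + 1)).1 - (D.flow t σ (i + 1)).1) := by
    simp only [force, interactionForce, add_sub_cancel_right]
    ring
  show ((D.orbitPair i σ t).2, (D.orbitPair i σ t).2 + Function.invFun (deriv P.V)
      (iteratedDeriv 2 (fun s => (D.orbitPair i σ s).2) t + deriv P.U (D.orbitPair i σ t).2 +
        deriv P.V ((D.orbitPair i σ t).2 - (D.orbitPair i σ t).1))) = D.orbitPair (i + 1) σ t
  rw [h2]
  simp only [InfiniteChainDynamics.orbitPair_apply]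
  rw [key, Function.leftInverse_invFun hinj, add_sub_cancel]

/-- Along orbits in the carrier, `𝒮 ∘ pairPathOf i = pairPathOf (i+1)`. [folklore] -/
theorem spatialShift_pairPathOf (D : InfiniteChainDynamics P) (hinj : Injective (deriv P.V))
    (hU : ContDiff ℝ ∞ P.U) (hV : ContDiff ℝ ∞ P.V) {σ : ChainConfig} (hσ : σ ∈ D.carrier)
    (i : ℤ) : P.spatialShift (D.pairPathOf i σ) = D.pairPathOf (i + 1) σ := by
  show SmoothPairPath.ofFun (P.spatialShiftFun (D.pairPathOf i σ).1) =
    SmoothPairPath.ofFun (D.orbitPair (i + 1) σ)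
  rw [D.coe_pairPathOf hU hV hσ i, P.spatialShiftFun_orbitPair D hinj hσ i]

/-! ### The equilibrium process and the fixed-point property -/

/-- The hypotheses of the **stationary, translation-invariant infinite-volume equilibrium
process** at temperature `T`: `T > 0`, `μ` is a Gibbs state of `P` at `T` (DLR, LLL 1977 §4),
the dynamics `D` preserves `μ` (`μ`-a.e. configuration is admissible and every `φ_t` is measure
preserving — a claim, not printed in LLL 1977 for the infinite-volume flow), and both the carrier
of `D` and `μ` are invariant under the lattice translation `τ`. Existence (LLL 1977 Thms 3–4 give
a.e. existence/uniqueness of the motion) is not asserted. [cite: LanfordLebowitzLieb1977, §4 Thms 3–4] -/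
structure IsEquilibriumProcess (T : ℝ) (D : InfiniteChainDynamics P) (μ : Measure ChainConfig) :
    Prop where
  /-- positive temperature -/
  pos : 0 < T
  /-- `μ` is a Gibbs state of the chain at temperature `T` -/
  gibbs : P.IsChainGibbsMeasure T μ
  /-- the flow preserves `μ` -/
  preserves : D.PreservesMeasure μ
  /-- the carrier is translation invariant -/
  shift_carrier : ∀ σ, OscillatorChain.latticeShift σ ∈ D.carrier ↔ σ ∈ D.carrier
  /-- `μ` is translation invariant -/
  shift_invariant : μ.map OscillatorChain.latticeShift = μ

namespace IsEquilibriumProcess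

variable {P} {T : ℝ} {D : InfiniteChainDynamics P} {μ : Measure ChainConfig}

/-- The state of an equilibrium process is a probability measure. [folklore] -/
theorem isProbabilityMeasure (h : P.IsEquilibriumProcess T D μ) : IsProbabilityMeasure μ :=
  h.gibbs.isProbabilityMeasure

/-- `G_T` of an equilibrium process is a probability law (smooth potentials). [folklore] -/
theorem isProbabilityMeasure_equilibriumPairPathLaw (h : P.IsEquilibriumProcess T D μ)
    (hU : ContDiff ℝ ∞ P.U) (hV : ContDiff ℝ ∞ P.V) :
    IsProbabilityMeasure (P.equilibriumPairPathLaw D μ) :=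
  haveI := h.isProbabilityMeasure
  P.isProbabilityMeasure_equilibriumPairPathLaw hU hV D h.preserves

/-- **(i)** `G_T` of an equilibrium process is time-stationary. [folklore] -/
theorem isTimeStationary_equilibriumPairPathLaw (h : P.IsEquilibriumProcess T D μ)
    (hU : ContDiff ℝ ∞ P.U) (hV : ContDiff ℝ ∞ P.V) :
    SmoothPairPath.IsTimeStationary (P.equilibriumPairPathLaw D μ) :=
  P.isTimeStationary_equilibriumPairPathLaw hU hV D h.preserves

/-- **(ii), marginal form:** every adjacent pair of an equilibrium process has the law `G_T`.
[folklore] -/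
theorem sitePairPathLaw_eq (h : P.IsEquilibriumProcess T D μ) (hU : ContDiff ℝ ∞ P.U)
    (hV : ContDiff ℝ ∞ P.V) (i : ℤ) : D.sitePairPathLaw μ i = P.equilibriumPairPathLaw D μ :=
  P.sitePairPathLaw_eq_equilibriumPairPathLaw hU hV D h.preserves h.shift_carrier
    h.shift_invariant i

/-- `𝒮 (q_0, q_1) = (q_1, q_2)` almost surely under an equilibrium process (`V'` injective).
[folklore] -/
theorem spatialShift_pairPathOf_ae (h : P.IsEquilibriumProcess T D μ)
    (hinj : Injective (deriv P.V)) (hU : ContDiff ℝ ∞ P.U) (hV : ContDiff ℝ ∞ P.V) (i : ℤ) :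
    ∀ᵐ σ ∂μ, P.spatialShift (D.pairPathOf i σ) = D.pairPathOf (i + 1) σ := by
  filter_upwards [h.preserves.1] with σ hσ using P.spatialShift_pairPathOf D hinj hU hV hσ i

/-- **(ii) The fixed-point property `𝒮_* G_T = G_T`.** For an equilibrium process of a chain with
smooth `U, V`, `V'` injective and `(V')⁻¹` smooth (e.g. `pinnedChain` with `β > 0`), the
equilibrium pair-path law is a fixed point of the spatial transfer map: `𝒮` maps the pair at
sites `(0,1)` to the pair at sites `(1,2)` a.s., whose law is again `G_T` by translation
invariance. [folklore] -/
theorem spatialTransfer_equilibriumPairPathLaw (h : P.IsEquilibriumProcess T D μ)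
    (hinj : Injective (deriv P.V)) (hU : ContDiff ℝ ∞ P.U) (hV : ContDiff ℝ ∞ P.V)
    (hW : ContDiff ℝ ∞ (Function.invFun (deriv P.V))) :
    P.spatialTransfer (P.equilibriumPairPathLaw D μ) = P.equilibriumPairPathLaw D μ := by
  have hae : AEMeasurable (D.pairPathOf 0) μ := D.aemeasurable_pairPathOf hU hV h.preserves 0
  calc (μ.map (D.pairPathOf 0)).map P.spatialShift
      = μ.map (P.spatialShift ∘ D.pairPathOf 0) :=
        AEMeasurable.map_map_of_aemeasurable (P.measurable_spatialShift hU hV hW).aemeasurable hae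
    _ = μ.map (D.pairPathOf (0 + 1)) :=
        Measure.map_congr (h.spatialShift_pairPathOf_ae hinj hU hV 0)
    _ = μ.map (D.pairPathOf 0) := D.sitePairPathLaw_succ hU hV h.preserves h.shift_carrier
        h.shift_invariant 0

end IsEquilibriumProcess

/-! ### The hypotheses for `pinnedChain` -/

/-- A smooth strictly monotone surjection `f : ℝ → ℝ` with nowhere-vanishing derivative has a
smooth inverse `Function.invFun f` (the easy half of the inverse function theorem, Mathlib
`Homeomorph.contDiff_symm_deriv`, transported to `Function.invFun`). [folklore] -/
theorem contDiff_invFun_of_strictMono {f : ℝ → ℝ} {n : WithTop ℕ∞} (hf : ContDiff ℝ n f)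
    (hmono : StrictMono f) (hsurj : Surjective f) (hf' : ∀ x, deriv f x ≠ 0) (hn : n ≠ 0) :
    ContDiff ℝ n (Function.invFun f) := by
  let e : ℝ ≃o ℝ := hmono.orderIsoOfSurjective f hsurj
  let H : ℝ ≃ₜ ℝ := e.toHomeomorph
  have hH : (H : ℝ → ℝ) = f := rfl
  have hsymm : ContDiff ℝ n (H.symm : ℝ → ℝ) :=
    H.contDiff_symm_deriv hf' (fun x => by rw [hH]; exact (hf.differentiable hn x).hasDerivAt)
      (by rw [hH]; exact hf)
  have hinv : Function.invFun f = (H.symm : ℝ → ℝ) := by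
    funext y
    obtain ⟨x, rfl⟩ := hsurj y
    rw [Function.leftInverse_invFun hmono.injective x]
    exact (e.symm_apply_apply x).symm
  rw [hinv]
  exact hsymm

/-- For the pinned anharmonic chain (`V(r) = r²/2 + βr⁴/4`, `β ≥ 0`): `V'(r) = r + βr³` is a
smooth strictly increasing bijection with `V'' = 1 + 3βr² > 0`, so `(V')⁻¹` is smooth and `V'` is
injective — the hypotheses `hW`, `hinj` of `spatialTransfer_equilibriumPairPathLaw`. [folklore] -/
theorem pinnedChain_contDiff_invFun_deriv_V (ω₂ lam γ : ℝ) {β : ℝ} (hβ : 0 ≤ β) :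
    ContDiff ℝ ∞ (Function.invFun (deriv (pinnedChain ω₂ lam β γ).V)) ∧
      Injective (deriv (pinnedChain ω₂ lam β γ).V) := by
  have hV : deriv (pinnedChain ω₂ lam β γ).V = fun r => r + β * r ^ 3 := by
    funext r
    have h : HasDerivAt (fun r : ℝ => r ^ 2 / 2 + β * r ^ 4 / 4)
        ((2 : ℕ) * r ^ (2 - 1) / 2 + β * ((4 : ℕ) * r ^ (4 - 1)) / 4) r :=
      ((hasDerivAt_pow 2 r).div_const 2).add (((hasDerivAt_pow 4 r).const_mul β).div_const 4)
    rw [show (pinnedChain ω₂ lam β γ).V = fun r : ℝ => r ^ 2 / 2 + β * r ^ 4 / 4 from rfl, h.deriv]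
    push_cast
    ring
  have hmono : StrictMono fun r : ℝ => r + β * r ^ 3 :=
    strictMono_id.add_monotone (((Odd.strictMono_pow (by decide : Odd 3)).monotone).const_mul hβ)
  rw [hV]
  refine ⟨?_, hmono.injective⟩
  have hsm : ContDiff ℝ ∞ fun r : ℝ => r + β * r ^ 3 := by fun_prop
  have hd : ∀ r : ℝ, deriv (fun r : ℝ => r + β * r ^ 3) r = 1 + 3 * β * r ^ 2 := fun r => by
    have h : HasDerivAt (fun r : ℝ => r + β * r ^ 3) (1 + β * ((3 : ℕ) * r ^ (3 - 1))) r :=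
      (hasDerivAt_id r).add ((hasDerivAt_pow 3 r).const_mul β)
    rw [h.deriv]
    push_cast
    ring
  have hd0 : ∀ r : ℝ, deriv (fun r : ℝ => r + β * r ^ 3) r ≠ 0 := fun r => by
    rw [hd]
    positivity
  have htop : Tendsto (fun r : ℝ => r + β * r ^ 3) atTop atTop :=
    tendsto_id.atTop_add_zero_eventuallyLE
      ((eventually_ge_atTop 0).mono fun r hr => show (0 : ℝ) ≤ β * r ^ 3 by positivity)
  have hbot : Tendsto (fun r : ℝ => r + β * r ^ 3) atBot atBot :=
    tendsto_id.atBot_add_eventuallyLE_zero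
      ((eventually_le_atBot 0).mono fun r hr => show β * r ^ 3 ≤ (0 : ℝ) from
        mul_nonpos_of_nonneg_of_nonpos hβ (Odd.pow_nonpos (by decide : Odd 3) hr))
  exact contDiff_invFun_of_strictMono hsm hmono (hsm.continuous.surjective htop hbot) hd0
    (by simp)

/-- **`𝒮_* G_T = G_T` for the pinned anharmonic chain**: for `pinnedChain ω₂ lam β γ` with `β ≥ 0`
all regularity hypotheses of `IsEquilibriumProcess.spatialTransfer_equilibriumPairPathLaw` hold
(polynomial potentials, `V'` a smooth diffeomorphism of `ℝ`), so the equilibrium pair-path law of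
every stationary translation-invariant equilibrium process is a fixed point of the spatial transfer
map. [folklore] -/
theorem IsEquilibriumProcess.spatialTransfer_equilibriumPairPathLaw_pinnedChain
    {ω₂ lam β γ T : ℝ} (hβ : 0 ≤ β) {D : InfiniteChainDynamics (pinnedChain ω₂ lam β γ)}
    {μ : Measure ChainConfig} (h : (pinnedChain ω₂ lam β γ).IsEquilibriumProcess T D μ) :
    (pinnedChain ω₂ lam β γ).spatialTransfer ((pinnedChain ω₂ lam β γ).equilibriumPairPathLaw D μ) =
      (pinnedChain ω₂ lam β γ).equilibriumPairPathLaw D μ := by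
  have hU : ContDiff ℝ ∞ (pinnedChain ω₂ lam β γ).U := by
    show ContDiff ℝ ∞ fun q : ℝ => ω₂ * q ^ 2 / 2 + lam * q ^ 4 / 4
    fun_prop
  have hV : ContDiff ℝ ∞ (pinnedChain ω₂ lam β γ).V := by
    show ContDiff ℝ ∞ fun r : ℝ => r ^ 2 / 2 + β * r ^ 4 / 4
    fun_prop
  obtain ⟨hW, hinj⟩ := pinnedChain_contDiff_invFun_deriv_V ω₂ lam γ hβ
  exact h.spatialTransfer_equilibriumPairPathLaw hinj hU hV hW

end OscillatorChain

end Literature.MathematicalPhysics.KineticTheory.HeatConduction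

end
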